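import Summits.QuantumFields.QCD.Theses.BanksZaksTestbed
import HarnessLib.Audit

/-!
# Birth skeleton (BC3) for the crux `InfraredCompletionP` (item stmt-QuantumFields-17633)

Route `BanksZaksTestbed` (sub-problem QCD), crux decl
`Summit.QuantumFields.QCD.Theses.BanksZaksTestbed.InfraredCompletionP` (rank 4; rev 2 of `InfraredCompletionR`
stmt-13788 ← stmt-9564, route-repair 2026-08-16 after the statement re-type p117723).  Registered by the
skeleton-registrar seat `planner-skel-stmt-QuantumFields-17633-0` (route re-audit bin REPAIRABLE, 2026-08-17) as
`Cruxes/InfraredCompletionP/Lines/birth.lean`.  It is the route-level BIRTH CERTIFICATE of the crux (three named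
stubs, a kernel-checked composition concluding the crux BY NAME, sorries only inside `stub_*`), deliberately
LINE-NEUTRAL: it cuts the crux along the route header's own intended proof / TWO-LAYER PLAN

  `InfraredCompletionP ⇐ ChiralPointLocation (m* ≥ 0, re-reference) → massive package above m* (thermodynamic limit,
   OS axioms, one gap) → GoldstoneFromAbove (IsChiralAtZero of the re-referenced regularisation)`,

placing the seams where the three pieces need DIFFERENT mechanisms, all of them stated on the LATTICE side of the
crux's own vocabulary (`QCDScheme.HasLatticeMassGap` along `reg.scheme`, exactly the predicate the pin
`reg.IsChiralAtZero` and the conjunct `QCDOf` are phrased over):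

* `stub_gappedLevel : GappedLevelStmt` — A UNIFORMLY GAPPED LEVEL EXISTS (the volume-uniform full-spectrum lattice gap of
  massive lattice QCD along the given regularisation, for all quarks heavier than some level `M₀`; YM-hard, open).
  For `N_f ∈ {2,3}`, every `reg` with the crux's four properties and the crux's finite-volume body there is `M₀ : ℝ`
  with `UniformGapAbove reg M₀`: for every `δ > 0` ONE rate `Δ > 0` serves every mass tuple `m + M₀` with `m_f ≥ δ`.
  (Nothing is claimed about the sign or sharpness of `M₀`; the prover may take it as large as the mechanism needs —
  but "heavy" is heavy in PHYSICAL units only: the bare masses still tend to `m_crit(k)`, so no hopping expansion.)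
* `stub_sharpThreshold : SharpThresholdStmt` — THE CHIRAL THRESHOLD IS SHARP (pseudo-Goldstone gaplessness from the
  massive side; open).  Same outer quantifiers; IF some level is uniformly gapped THEN there is a level `M` that is
  uniformly gapped above AND gapless from above: `GaplessAbove reg M` — for every `ε > 0` some tuple `m + M`, `m > 0`,
  has no uniform lattice gap `ε`.  (`M := inf` of the gapped levels is uniformly gapped for free; the content is that
  the failure of the gap just below `M` is visible from tuples strictly above `M` in every flavour — `m_π → 0` as
  `m → M⁺`, Gell-Mann–Oakes–Renner from above, volume-uniformly, along an asymptotically scaling Wilson regularisation.)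
* `stub_continuumAbove : ContinuumAboveStmt` — CONTINUUM MASSIVE QCD ABOVE A GAPPED NON-NEGATIVE LEVEL (thermodynamic
  limit + OS axioms + non-triviality / dynamical quarks + ONE gap of the full Hamiltonian, from the crux's in-ball
  finite-volume continuum limits and a SUPPLIED uniform lattice gap; open).  Same outer quantifiers; for every
  `M ≥ 0` with `UniformGapAbove reg M` and every `m > 0`: `MassiveQCDAt reg (m + M)` — verbatim the body of `QCDOf`
  at the tuple `m + M` of `reg` (`∃ z shift T, IsQCDAlong (reg.scheme (m+M) z shift) T ∧ IsNontrivial glue ∧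
  IsNonGaussian glue ∧ (∀ f ≠ g, IsNontrivial (pseudoRe f g)) ∧ ∃ Δ > 0, T.HasMassGap Δ ∧ HasLatticeMassGap Δ`).
  `M ≥ 0` is what lets the crux's body (stated for POSITIVE tuples only) feed the tuple `m + M`.

`InfraredCompletionP_of : GappedLevelStmt → SharpThresholdStmt → ContinuumAboveStmt → InfraredCompletionP` is
kernel-checked (§5) and is NOT a one-line seam: (i) the threshold `M` comes from S1 + S2; (ii) THE PIN AT WORK —
`0 ≤ M` is proved in the glue from `reg.IsChiralAtZero` and `UniformGapAbove reg M` (`chiralThreshold_nonneg`: were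
`M < 0`, the closed orthant `m_f ≥ −M` above `M` would carry one rate `Δ`, i.e. every positive tuple of `reg` would be
`Δ`-gapped, and the pin's `Δ`-gapless positive tuple refutes it) — this is exactly the route header's "the pin excludes
a reference ABOVE the chiral line"; (iii) RE-REFERENCING — the `∃ reg` of `QCDOf N_f` is witnessed by
`shiftReg reg M` (`m_crit(k) ↦ m_crit(k) + a_k M / Z_m(k)`, all other data unchanged), whose scheme at `m` IS `reg`'s
scheme at `m + M` (`shiftReg_scheme`, `funext` + `ring`), whose `HasMassScaling` is `reg`'s (same `a`, `Z_m`) and whose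
`IsChiralAtZero` is literally `GaplessAbove reg M` (`shiftReg_isChiralAtZero_iff`); (iv) the body of `QCDOf` at every
positive `m` is S3 at `m + M` transported along `shiftReg_scheme`.  `infraredCompletionP_of_stubs` instantiates it.

## Negative knowledge honoured (read 2026-08-17)
* `Cruxes/InfraredCompletionP/` had no workfiles (no `Disproof.lean`, no Ideas, no Lines) — `ledger crux ls
  stmt-QuantumFields-17633`.
* Refuter route review rreview1 (REVIEW.md on the item, 2026-08-16): the crux SURVIVES cheap attacks; STRUCTURE
  `I ≡ ∀ N_f ∈ [2,3], (P-body at N_f → QCDOf N_f)`, `QCD → I`; PROVER BRIEFING: "the pin excludes references ABOVE the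
  chiral line only … the proof must CLASSIFY all gapless positive parameters: m* := sup{gapless} < ∞ needs the
  heavy-quark (YM-like) gap; everything above m* must be honest massive QCD; re-reference at m*; Goldstone gaplessness
  from above gives IsChiralAtZero of the re-referenced reg."  This skeleton is that briefing, typed: S1 = the
  heavy-quark gap (a gapped level), S2 = the classification's sharp endpoint, S3 = honest massive QCD above it, the
  sign of m* and the re-referencing in the glue.
* `ledger negatives --problem QuantumFields` (5 entries: RobustYangMillsRG 14958, MirrorModularBoosts 9665,
  AdaptiveCoarseSystem 9494, MultibosonLatticeGap 9599, AdmissibleRootsExist 9603): none is a statement about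
  `HasLatticeMassGap` thresholds, Goldstone gaplessness or the continuum package; 9599 died of its multiboson
  admissibility clause (Chebyshev), which nothing here uses.
* Typing checklist 4c: no determinantal representation, no Bochner integral over a free `f` (the only integrals are the
  crux's own `qcdTorusExpect`), no complex-action positivity claim, no hand-picked threshold (`∃ M₀`, `∃ M`, `∀ δ ∃ Δ`).

## Audit (lean check --json, farm, 2026-08-17)
See the seat's NOTES.md `birth-certificate:` and `Lines/birth.md`: rc 0, sorries 3 = the three `stub_*`, zero
elsewhere; `InfraredCompletionP_of` axioms [propext, Classical.choice, Quot.sound].  `ledger skeleton check` (run on the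
seat's work copy `bc/InfraredCompletionP_birth.lean`, identical to this file except that the three `@[stub "birth"]` tags
on the §2 statement defs are LIVE there and commented in the tree copy — crux workfiles may not carry gate-reserved
attributes): OK — `InfraredCompletionP_of` concludes the crux, closed=True, stubs registered on stmt-QuantumFields-17633:
`stub_gappedLevel`, `stub_sharpThreshold`, `stub_continuumAbove`.

## BC3 probes
For each `S ∈ {GappedLevelStmt, SharpThresholdStmt, ContinuumAboveStmt}` and each target
`T ∈ {InfraredCompletionP, QCD}`: `example : S → T := by first | exact? | simpa [S, T] | aesop` (stub statement and
§1 vocabulary copied verbatim into `bc/birth_probe_<stub>.lean`, NO stub / composition in scope,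
`set_option maxHeartbeats 400000`) MUST FAIL — results in `Lines/birth.md` and NOTES.md.
-/

noncomputable section

namespace Summit.QuantumFields.QCD.Cruxes.InfraredCompletionP.Birth

open scoped BigOperators Topology Manifold Classical MeasureTheory ProbabilityTheory Matrix InnerProductSpace ComplexConjugate ContinuousMap
open Filter Set Function TopologicalSpace MeasureTheory
open Literature.MathematicalPhysics.QuantumFieldTheory

variable {Nf : ℕ}

/-! ## §1 Vocabulary (transparent abbreviations of the crux's own sub-formulas; no new notion) -/

/-- The crux's four hypotheses on the regularisation, VERBATIM: leading-log mass scaling, `N_f`-flavour two-loop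
asymptotic scaling, physical branch `m_crit(k) > −1` eventually, chiral at zero (the pin). -/
def RegHyp (reg : Literature.MathematicalPhysics.QuantumFieldTheory.QCDRegularisation Nf) : Prop :=
  (reg.HasMassScaling ∧ (∃ Λ > 0, Tendsto (fun k => reg.β k - Literature.MathematicalPhysics.QuantumFieldTheory.afBeta Nf Λ (reg.a k)) atTop (nhds 0)) ∧ (∀ᶠ k in atTop, (-1 : ℝ) < reg.mcrit k) ∧ reg.IsChiralAtZero)

/-- The crux's antecedent body, VERBATIM (= the body of `PinnedFiniteVolumeLimit` / `WindowFiniteVolumeLimitR` at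
`reg`): for every positive mass tuple the guarded, non-degenerate finite-volume continuum limits (in-ball
pairwise-disjoint CONV on the torus of every physical side `ℓ ≥ ℓ₀`; N2, N1, N3 in-ball separated). -/
def FVBody (reg : Literature.MathematicalPhysics.QuantumFieldTheory.QCDRegularisation Nf) : Prop :=
  (∀ m : Fin Nf → ℝ, (∀ fl, 0 < m fl) → ∃ z shift : Literature.MathematicalPhysics.QuantumFieldTheory.QCDField Nf → ℕ → ℝ, ∃ W : ((ℓ : ℝ) → (n : ℕ) → (Fin n → Literature.MathematicalPhysics.QuantumFieldTheory.QCDField Nf) → (Fin n → SchwartzMap (EuclideanSpace ℝ (Fin 4)) ℝ) → ℂ), ∃ ℓ₀ > 0, (∀ ℓ : ℝ, ℓ₀ ≤ ℓ → ∀ (n : ℕ) (σ : Fin n → Literature.MathematicalPhysics.QuantumFieldTheory.QCDField Nf) (f : Fin n → SchwartzMap (EuclideanSpace ℝ (Fin 4)) ℝ), (∀ i : Fin n, tsupport (f i) ⊆ Metric.ball 0 (ℓ / 4)) → (∀ i j : Fin n, i ≠ j → Disjoint (tsupport (f i)) (tsupport (f j))) → Tendsto (fun k => Literature.MathematicalPhysics.QuantumFieldTheory.qcdTorusExpect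 (reg.β k) (2 * ⌊ℓ / (2 * reg.a k)⌋₊ + 1) (fun fl => (reg.scheme m 0 0).mq fl k) (fun U => (List.ofFn fun i : Fin n => (∑ x ∈ Literature.Probability.LatticeModels.box 4 ⌊ℓ / (2 * reg.a k)⌋₊, ((z (σ i) k * reg.a k ^ 4 * (f i) (reg.a k • Literature.MathematicalPhysics.QuantumLattice.siteToE x) : ℝ) : ℂ) • (Literature.MathematicalPhysics.QuantumFieldTheory.insertion U (σ i) x - algebraMap ℂ _ (((shift (σ i) k) : ℝ) : ℂ)))).prod)) atTop (nhds (W ℓ n σ f))) ∧ (∀ fl gl : Fin Nf, fl ≠ gl → ∃ ℓ : ℝ, ℓ₀ ≤ ℓ ∧ ∃ f g : SchwartzMap (EuclideanSpace ℝ (Fin 4)) ℝ, tsupport f ⊆ Metric.ball 0 (ℓ / 4) ∧ tsupport g ⊆ Metric.ball 0 (ℓ / 4) ∧ tsupport f ⊆ {x | x 0 < 0} ∧ tsupport g ⊆ {x | 0 < x 0} ∧ W ℓ 2 (fun _ => Literature.MathematicalPhysics.QuantumFieldTheory.QCDField.pseudoRe fl gl) ![f, g] ≠ W ℓ 1 (fun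 _ => Literature.MathematicalPhysics.QuantumFieldTheory.QCDField.pseudoRe fl gl) ![f] * W ℓ 1 (fun _ => Literature.MathematicalPhysics.QuantumFieldTheory.QCDField.pseudoRe fl gl) ![g]) ∧ ∀ s₀ : Literature.MathematicalPhysics.QuantumFieldTheory.QCDField Nf, s₀ = Literature.MathematicalPhysics.QuantumFieldTheory.QCDField.glue → (∃ ℓ : ℝ, ℓ₀ ≤ ℓ ∧ ∃ f g : SchwartzMap (EuclideanSpace ℝ (Fin 4)) ℝ, tsupport f ⊆ Metric.ball 0 (ℓ / 4) ∧ tsupport g ⊆ Metric.ball 0 (ℓ / 4) ∧ tsupport f ⊆ {x | x 0 < 0} ∧ tsupport g ⊆ {x | 0 < x 0} ∧ W ℓ 2 (fun _ => s₀) ![f, g] ≠ W ℓ 1 (fun _ => s₀) ![f] * W ℓ 1 (fun _ => s₀) ![g]) ∧ (∃ ℓ : ℝ, ℓ₀ ≤ ℓ ∧ ∃ f g h : SchwartzMap (EuclideanSpace ℝ (Fin 4)) ℝ, tsupport f ⊆ Metric.ball 0 (ℓ / 4) ∧ tsupport g ⊆ Metric.ball 0 (ℓ / 4) ∧ tsupport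 h ⊆ Metric.ball 0 (ℓ / 4) ∧ Disjoint (tsupport f) (tsupport g) ∧ Disjoint (tsupport f) (tsupport h) ∧ Disjoint (tsupport g) (tsupport h) ∧ W ℓ 3 (fun _ => s₀) ![f, g, h] - W ℓ 1 (fun _ => s₀) ![f] * W ℓ 2 (fun _ => s₀) ![g, h] - W ℓ 1 (fun _ => s₀) ![g] * W ℓ 2 (fun _ => s₀) ![f, h] - W ℓ 1 (fun _ => s₀) ![h] * W ℓ 2 (fun _ => s₀) ![f, g] + 2 * (W ℓ 1 (fun _ => s₀) ![f] * W ℓ 1 (fun _ => s₀) ![g] * W ℓ 1 (fun _ => s₀) ![h]) ≠ 0))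

/-- The body of the conjunct `QCDOf N_f` at ONE mass tuple `m` of `reg`, VERBATIM: OS data tied to lattice QCD along
`reg.scheme m z shift`, non-trivial non-Gaussian glue, dynamical quarks, one gap `Δ > 0` of the full Hamiltonian
(continuum `T.HasMassGap Δ` and lattice `HasLatticeMassGap Δ` at the same scheme). -/
def MassiveQCDAt (reg : Literature.MathematicalPhysics.QuantumFieldTheory.QCDRegularisation Nf) (m : Fin Nf → ℝ) : Prop :=
  ∃ (z shift : Literature.MathematicalPhysics.QuantumFieldTheory.QCDField Nf → ℕ → ℝ) (T : Literature.MathematicalPhysics.QuantumFieldTheory.OSData (Literature.MathematicalPhysics.QuantumFieldTheory.QCDField Nf) 4),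
    Literature.MathematicalPhysics.QuantumFieldTheory.IsQCDAlong (reg.scheme m z shift) T ∧ T.IsNontrivial Literature.MathematicalPhysics.QuantumFieldTheory.QCDField.glue ∧
      T.IsNonGaussian Literature.MathematicalPhysics.QuantumFieldTheory.QCDField.glue ∧
        (∀ f g : Fin Nf, f ≠ g → T.IsNontrivial (Literature.MathematicalPhysics.QuantumFieldTheory.QCDField.pseudoRe f g)) ∧
          ∃ Δ > 0, T.HasMassGap Δ ∧ (reg.scheme m z shift).HasLatticeMassGap Δ

/-- **Uniformly gapped above the level `M`**: for every `δ > 0` ONE rate `Δ > 0` is a volume-uniform full-spectrum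
lattice gap (`QCDScheme.HasLatticeMassGap`, the predicate of the pin and of `QCDOf`) of the lattice theory of `reg`
at EVERY mass tuple `m + M` with `m_f ≥ δ` for all flavours (the closed `δ`-orthant above `M`; `z = shift = 0`, which
the predicate does not read). [physics: the gap of massive QCD is bounded below on `{m_f ≥ M + δ}` by the lighter of
the lightest pseudoscalar at mass `δ` above threshold and the glueball] -/
def UniformGapAbove (reg : Literature.MathematicalPhysics.QuantumFieldTheory.QCDRegularisation Nf) (M : ℝ) : Prop :=
  ∀ δ > (0 : ℝ), ∃ Δ > (0 : ℝ), ∀ m : Fin Nf → ℝ, (∀ f, δ ≤ m f) →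
    (reg.scheme (fun f => m f + M) 0 0).HasLatticeMassGap Δ

/-- **Gapless from above at the level `M`**: for every `ε > 0` some tuple `m + M` with ALL `m_f > 0` has no uniform
lattice gap `ε` — the lattice gap closes as the masses approach `M` from above (pseudo-Goldstone bosons,
`m_π² ∝ m_q`).  At `M = 0` this is `reg.IsChiralAtZero` verbatim; in general it is `IsChiralAtZero` of the
re-referenced regularisation (`shiftReg_isChiralAtZero_iff`). [cite: GellmannOakesRenner1968] -/
def GaplessAbove (reg : Literature.MathematicalPhysics.QuantumFieldTheory.QCDRegularisation Nf) (M : ℝ) : Prop :=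
  ∀ ε > (0 : ℝ), ∃ m : Fin Nf → ℝ, (∀ f, 0 < m f) ∧
    ¬ (reg.scheme (fun f => m f + M) 0 0).HasLatticeMassGap ε

/-! ## §2 The three stub statements (`@[stub "birth"]` obligation nodes = the admissible hypotheses of `InfraredCompletionP_of`) -/

/-- **(S1) A uniformly gapped level exists** (open; YM-hard).  For `N_f ∈ {2,3}` and every regularisation with the
crux's four properties whose finite-volume body holds, SOME level `M₀` is uniformly gapped above: massive lattice QCD
along `reg` has a volume-uniform full-spectrum lattice gap for all quarks heavier than `M₀`, with one rate per closed
orthant.  Why plausibly true: heavy dynamical quarks are a small, quasi-local perturbation of the pure-gauge measure at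
physical scales (decoupling), and the pure-gauge theory is believed gapped; the crux's own finite-volume continuum
limits fix the scale.  Why it might fail: it CONTAINS a Yang–Mills-type lattice mass gap at weak coupling along every
asymptotically scaling regularisation (no theorem in d = 4), uniformly over a non-compact set of masses. -/
-- @[stub "birth"] (tag LIVE in the registrar seat's registered work copy `bc/InfraredCompletionP_birth.lean`, on which `ledger skeleton check` ran; commented here: crux workfiles may not carry gate-reserved attributes)
def GappedLevelStmt : Prop :=
  ∀ Nf : ℕ, 2 ≤ Nf → Nf ≤ 3 → ∀ reg : Literature.MathematicalPhysics.QuantumFieldTheory.QCDRegularisation Nf, RegHyp reg → FVBody reg →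
    ∃ M₀ : ℝ, UniformGapAbove reg M₀

/-- **(S2) The chiral threshold is sharp** (open; Goldstone from above).  Same outer quantifiers; if some level is
uniformly gapped above, then some level `M` is BOTH uniformly gapped above and gapless from above.  Why plausibly
true: the gapped levels form an up-set bounded below (by `0`, the pin); its infimum `M` is uniformly gapped above for
free, and at `M` the lightest flavoured pseudoscalar becomes massless continuously from the massive side
(Gell-Mann–Oakes–Renner, chiral perturbation theory), so tuples strictly above `M` in every flavour already have
arbitrarily small gaps — a LOWER bound on a meson correlator, volume-uniformly, eventually in `k`.  Why it might fail:
a first-order chiral transition at the threshold (gap jumping to zero only AT or below `M`, e.g. through flavour-split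
directions for `N_f = 3`), or Wilson-fermion lattice artefacts (Aoki phase / Sharpe–Singleton scenario) surviving in
the `k`-eventual, volume-uniform sense. -/
-- @[stub "birth"] (tag LIVE in the registrar seat's registered work copy `bc/InfraredCompletionP_birth.lean`, on which `ledger skeleton check` ran; commented here: crux workfiles may not carry gate-reserved attributes)
def SharpThresholdStmt : Prop :=
  ∀ Nf : ℕ, 2 ≤ Nf → Nf ≤ 3 → ∀ reg : Literature.MathematicalPhysics.QuantumFieldTheory.QCDRegularisation Nf, RegHyp reg → FVBody reg →
    (∃ M₀ : ℝ, UniformGapAbove reg M₀) → ∃ M : ℝ, UniformGapAbove reg M ∧ GaplessAbove reg M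

/-- **(S3) Continuum massive QCD above a gapped non-negative level** (open; the thermodynamic-limit / OS /
gap-inheritance package).  Same outer quantifiers; for every `M ≥ 0` that is uniformly gapped above and every
positive tuple `m`, the body of `QCDOf N_f` holds VERBATIM at the tuple `m + M` of `reg`: OS data `T` with
`IsQCDAlong (reg.scheme (m + M) z shift) T` (continuum limit of ALL off-diagonal `n`-point functions along the
scheme's growing tori, asymptotic scaling, physical branch), non-trivial and non-Gaussian glue, every flavour-changing
pseudoscalar non-trivial, and one `Δ > 0` with `T.HasMassGap Δ` and the lattice gap `Δ` at the same scheme.  Why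
plausibly true: `M ≥ 0` makes `m + M` a positive tuple, so the crux's body supplies the in-ball finite-volume continuum
limits `W ℓ` with N1–N3 there; the SUPPLIED volume-uniform lattice gap gives `ℓ`-independence of `W ℓ` up to
`O(e^{−Δℓ/4})` (thermodynamic limit from in-ball torus data), exponential clustering hence E4 and `T.HasMassGap`,
while E1–E3 come from the lattice symmetries / Osterwalder–Seiler positivity in the limit and N1–N3 give the three
non-degeneracy clauses.  Why it might fail: OS reconstruction needs reflection positivity of the LIMIT, which the
time-periodic `qcdTorusExpect` does not hand over configuration-wise; `T.HasMassGap` for the full species algebra from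
two-point clustering needs spectral (not just clustering) control; `HasLatticeMassGap`'s constants are per observable
pair, so smeared `k`-dependent fields are not controlled uniformly without a transfer-matrix bound. -/
-- @[stub "birth"] (tag LIVE in the registrar seat's registered work copy `bc/InfraredCompletionP_birth.lean`, on which `ledger skeleton check` ran; commented here: crux workfiles may not carry gate-reserved attributes)
def ContinuumAboveStmt : Prop :=
  ∀ Nf : ℕ, 2 ≤ Nf → Nf ≤ 3 → ∀ reg : Literature.MathematicalPhysics.QuantumFieldTheory.QCDRegularisation Nf, RegHyp reg → FVBody reg →
    ∀ M : ℝ, 0 ≤ M → UniformGapAbove reg M → ∀ m : Fin Nf → ℝ, (∀ f, 0 < m f) →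
      MassiveQCDAt reg (fun f => m f + M)

/-! ## §3 The registered stubs (the ONLY `sorry`s of this file) -/

/-- (S1) a uniformly gapped level exists — open (YM-hard lattice gap with heavy dynamical quarks). -/
theorem stub_gappedLevel : GappedLevelStmt := by
  sorry

/-- (S2) the chiral threshold is sharp — open (pseudo-Goldstone gaplessness from the massive side). -/
theorem stub_sharpThreshold : SharpThresholdStmt := by
  sorry

/-- (S3) continuum massive QCD above a gapped non-negative level — open (thermodynamic limit, OS axioms, one gap). -/
theorem stub_continuumAbove : ContinuumAboveStmt := by
  sorry

/-! ## §4 Glue (sorry-free): the re-referenced regularisation and the pin at work -/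

/-- **Re-referencing**: the regularisation `reg` with its reference critical mass moved UP by the renormalised amount
`M`, `m_crit(k) ↦ m_crit(k) + a_k M / Z_m(k)`; spacings, couplings, volumes and `Z_m` unchanged. [folklore] -/
def shiftReg (reg : Literature.MathematicalPhysics.QuantumFieldTheory.QCDRegularisation Nf) (M : ℝ) : Literature.MathematicalPhysics.QuantumFieldTheory.QCDRegularisation Nf where
  a := reg.a
  a_pos := reg.a_pos
  tendsto_a := reg.tendsto_a
  β := reg.β
  L := reg.L
  tendsto_L := reg.tendsto_L
  mcrit := fun k => reg.mcrit k + reg.a k * M / reg.Zm k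
  Zm := reg.Zm
  Zm_pos := reg.Zm_pos

/-- The scheme of the re-referenced regularisation at `m` IS the scheme of `reg` at `m + M`
(`m_crit + aM/Z_m + a m_f/Z_m = m_crit + a (m_f + M)/Z_m`). [folklore] -/
theorem shiftReg_scheme (reg : Literature.MathematicalPhysics.QuantumFieldTheory.QCDRegularisation Nf) (M : ℝ) (m : Fin Nf → ℝ)
    (z shift : Literature.MathematicalPhysics.QuantumFieldTheory.QCDField Nf → ℕ → ℝ) :
    (shiftReg reg M).scheme m z shift = reg.scheme (fun f => m f + M) z shift := by
  simp only [QCDRegularisation.scheme, shiftReg, QCDScheme.mk.injEq, and_true, true_and]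
  funext f k
  ring

/-- Re-referencing does not touch `a` or `Z_m`: mass scaling is inherited. [folklore] -/
theorem shiftReg_hasMassScaling_iff (reg : Literature.MathematicalPhysics.QuantumFieldTheory.QCDRegularisation Nf) (M : ℝ) :
    (shiftReg reg M).HasMassScaling ↔ reg.HasMassScaling :=
  Iff.rfl

/-- `IsChiralAtZero` of the re-referenced regularisation is literally `GaplessAbove reg M`. [folklore] -/
theorem shiftReg_isChiralAtZero_iff (reg : Literature.MathematicalPhysics.QuantumFieldTheory.QCDRegularisation Nf) (M : ℝ) :
    (shiftReg reg M).IsChiralAtZero ↔ GaplessAbove reg M := by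
  simp only [QCDRegularisation.IsChiralAtZero, GaplessAbove, shiftReg_scheme]

/-- **The pin at work**: a level that is uniformly gapped above cannot lie ABOVE the reference (`M < 0`), because then
every positive tuple of `reg` would carry one rate `Δ` and the pin `reg.IsChiralAtZero` exhibits a positive tuple
without it.  Hence the chiral threshold is `≥ 0` and the crux's body (positive tuples only) reaches every tuple above
it. [folklore] -/
theorem chiralThreshold_nonneg {reg : Literature.MathematicalPhysics.QuantumFieldTheory.QCDRegularisation Nf} {M : ℝ}
    (hpin : reg.IsChiralAtZero) (hgap : UniformGapAbove reg M) : 0 ≤ M := by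
  by_contra hneg
  obtain ⟨Δ, hΔ, hΔgap⟩ := hgap (-M) (by linarith [not_le.mp hneg])
  obtain ⟨m₀, hm₀, hnogap⟩ := hpin Δ hΔ
  apply hnogap
  have h := hΔgap (fun f => m₀ f - M) (fun f => by linarith [hm₀ f])
  simpa only [sub_add_cancel] using h

/-! ## §5 Composition (kernel-checked; no `sorry` below this line) -/

/-- **The crux from the three stubs** (concludes `InfraredCompletionP` BY NAME).  Threshold `M` from (S1)+(S2);
`0 ≤ M` by the pin (`chiralThreshold_nonneg`); witness `shiftReg reg M` for the `∃ reg` of `QCDOf N_f`: mass scaling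
inherited, `IsChiralAtZero` = gapless from above at `M`, and the body at every positive `m` is (S3) at `m + M`
transported along `shiftReg_scheme`. -/
theorem InfraredCompletionP_of :
    GappedLevelStmt → SharpThresholdStmt → ContinuumAboveStmt →
      Summit.QuantumFields.QCD.Theses.BanksZaksTestbed.InfraredCompletionP := by
  intro hG hS hC Nf h2 h3 reg hreg hbody
  obtain ⟨M, hgap, hgapless⟩ := hS Nf h2 h3 reg hreg hbody (hG Nf h2 h3 reg hreg hbody)
  have hM : 0 ≤ M := chiralThreshold_nonneg hreg.2.2.2 hgap
  refine ⟨shiftReg reg M, (shiftReg_hasMassScaling_iff reg M).mpr hreg.1,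
    (shiftReg_isChiralAtZero_iff reg M).mpr hgapless, fun m hm => ?_⟩
  have hmass : MassiveQCDAt reg (fun f => m f + M) := hC Nf h2 h3 reg hreg hbody M hM hgap m hm
  simpa only [MassiveQCDAt, shiftReg_scheme] using hmass

/-- The crux along this skeleton, from the registered stubs (sorries only inside `stub_*`). -/
theorem infraredCompletionP_of_stubs :
    Summit.QuantumFields.QCD.Theses.BanksZaksTestbed.InfraredCompletionP :=
  InfraredCompletionP_of stub_gappedLevel stub_sharpThreshold stub_continuumAbove

end Summit.QuantumFields.QCD.Cruxes.InfraredCompletionP.Birth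

end
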